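import Mathlib
import Summits.FinalStateConjecture.FinalStateConjecture.Theorems.RunbookKerrSkeletonSanity

/-!
# Runbook sanity module (2) — the node-level statement `mainTheorem_of_nodes` is not vacuous either

`RunbookKerrSkeletonSanity` exhibits a toy setting meeting all twenty-five hypotheses of
`Literature.Geometry.Lorentzian.KlainermanSzeftel2021.Bootstrap.mainTheorem_of_leaves`.  The review
runbook of `papers/FinalStateConjecture/kerr-skeleton` also cards the NODE-level theorem
`mainTheorem_of_nodes` (thirteen hypotheses: Theorems M3–M8 as stated, `FlowClosed`, `SmallEps`,
`LimitExists`, `ThmConclusions`, the admissible regime, `ε0 < 1`, the initial-data comparison), and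
its joint-satisfiability search (review-runbook/9.83, runbook-probe/12) finds the leaf-level witness
meeting only seven of those thirteen — `ThmM3`, `ThmM4`, `ThmM5`, `ThmM7`, `ThmM8`, `SmallEps` are
not conjuncts of it.  They do hold in the same toy setting, by the tree's own leaf-to-node edges
(`thmM3_of_M1_M2`, `thmM4_of_M3`, `thmM5_of_M4`, `thmM7_of_ch8`, `thmM8_of_ch9 ∘ mainPT_of_subnodes`,
`smallEps_of_admissible`); this file records that as one closed `∃` statement in the binder order of
`mainTheorem_of_nodes` (the theorem instantiated at the toy objects has the type of the already-landed
`toy_mainTheoremV2` and is not restated).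

(b)-type sanity witnesses for the review runbook only; no claim about Kerr stability.
-/

namespace Summit.FinalStateConjecture.Runbook.KerrSkeleton

open Literature.Geometry.Lorentzian.KlainermanSzeftel2021.Bootstrap

/-- Theorem M3 as stated holds in the toy setting (from the toy M1, M2 and the edge `ThmM3fromM1M2`). -/
theorem toy_thmM3 (lim : Prop) : ThmM3 toyLes (toySetting lim) :=
  thmM3_of_M1_M2 (toy_thmM1 lim) (toy_thmM2 lim) (toy_thmM3fromM1M2 lim)

/-- Theorem M4 as stated holds in the toy setting (edge `ThmM4fromM3`). -/
theorem toy_thmM4 (lim : Prop) : ThmM4 toyLes (toySetting lim) :=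
  thmM4_of_M3 (toy_thmM3 lim) (toy_thmM4fromM3 lim)

/-- Theorem M5 as stated holds in the toy setting (edge `ThmM5fromM4`). -/
theorem toy_thmM5 (lim : Prop) : ThmM5 toyLes (toySetting lim) :=
  thmM5_of_M4 (toy_thmM4 lim) (toy_thmM5fromM4 lim)

/-- Theorem M7 as stated holds in the toy setting (the chapter-8 sub-nodes assembled by `thmM7_of_ch8`
with the toy M7 objects). -/
theorem toy_thmM7 (lim : Prop) : ThmM7 toyLes (toySetting lim) :=
  thmM7_of_ch8 (toy_m7Extend lim) (toy_m7NewSlice lim) (toy_m7Assemble lim)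

/-- Theorem M8 as stated holds in the toy setting (the chapter-9 sub-nodes: `MainPT` from
`ThmM0PT`, `IterBase`, `IterStep`, `IterTop`, then `thmM8_of_ch9`). -/
theorem toy_thmM8 (lim : Prop) : ThmM8 toyLes (toySetting lim) :=
  thmM8_of_ch9 toyLes (toySetting lim)
    (mainPT_of_subnodes (toy_thmM0PT lim) (toy_iterBase lim) (toy_iterStep lim) (toy_iterTop lim))
    (toy_baPTonExtension lim) (toy_m8ofPT lim)

/-- `SmallEps` holds for the toy constants (`ε0 = 1/8` is below both explicit thresholds
`(cM8 + cM7)⁻³ = 1/8` and `cM7⁻³ = 1` of `toyLes`). -/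
theorem toy_smallEps : SmallEps toyLes toyConstants :=
  smallEps_of_admissible toyLes admissible_toyConstants (by norm_num [toyLes]) (by norm_num [toyLes])
    (by norm_num [toyLes, toyConstants]) (by norm_num [toyLes, toyConstants])

/-- **NON-VACUITY of `mainTheorem_of_nodes`** — there are `c, K, S` satisfying ALL thirteen of its
hypotheses at once (binder for binder its hypothesis list: `hc, hε0, hext, hM3, hM4, hM5, hM6, hM7,
hM8, hflow, hsmall, hlim, hconcl`), namely the toy setting of `RunbookKerrSkeletonSanity` with a
limit object; so the node-level implication certified by the kernel is not `False → _` either. -/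
theorem hypotheses_jointly_satisfiable_nodes :
    ∃ (c : Constants) (K : LesConstants) (S : Setting c),
      c.Admissible ∧ c.ε0 < 1 ∧ S.idlExt3 ≤ S.idl (c.klarge + 10) ∧
      ThmM3 K S ∧ ThmM4 K S ∧ ThmM5 K S ∧ ThmM6 S ∧ ThmM7 K S ∧ ThmM8 K S ∧
      FlowClosed S ∧ SmallEps K c ∧ LimitExists K S ∧ ThmConclusions K S :=
  ⟨toyConstants, toyLes, toySetting True, admissible_toyConstants,
    by norm_num [toyConstants], le_rfl,
    toy_thmM3 _, toy_thmM4 _, toy_thmM5 _, toy_thmM6 _, toy_thmM7 _, toy_thmM8 _,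
    toy_flowClosed _, toy_smallEps, toy_limitExists, toy_thmConclusions _⟩

end Summit.FinalStateConjecture.Runbook.KerrSkeleton
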